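import Summits.ResolutionOfSingularities.ResolutionOfSingularities.Theorems.EquisingularLiftEquisingularLiftNatNDLeavesRungP5
import Summits.ResolutionOfSingularities.ResolutionOfSingularities.Theorems.EquisingularLiftEquisingularLiftNatResidueHypDefs7
import HarnessLib

/-!
# [OURS · L1 W4.5(b) · EL♮ / EL♮(3)] RESIDUE HYPOTHESIS DEFS 8 — the «IMMATURE HOST (key letter)» ISO blob (WIDTH TABLE D5, row D5-1; desk R53/R54/R55/R55′):
# `PrefixReachKeyLetterParam` (= res-L1-w45b-stub-2 g16's K5⁶ `hres` text v1.1 VERBATIM + crit-2's ONE adoption `Z.Infinite →` in (ii), parametric in `Reach ReachL LS Open`), its instances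
# `HyperplaneLetters`, `OpeningCertKeyLetter`, the predicate `PrefixReachKeyLetterP6`, the blob `IsoHypReachNDLeavesP6`, and the PURE inclusions from P / P5

PENS (desk R55): the `∀ Q` block is res-L1-w45b-stub-2 g16's `K56-hres-v1.1.lean` (sha16 df0014a1b76d223c) `PrefixReach6Draft` VERBATIM under the tree name
`PrefixReachKeyLetterParam` — state `Q F ρ T (Ls : List (Set F)) (Kp : Option (Set F × Set F × Set F))` (listed letters; the KEY-INCIDENCE TAG «the key letter
`K` contains the crossing curve of `A` and `C`»); clauses START · DROP · (Pc) point step + `Reach`-moves, letters dropped · (PL) initial-stage lettered `ReachL`-towers ·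
(i) lettered point step · (O) certified opening `Open` · (ii) pair round with the tag rule · (HR) hosted round · END `∃ Ls Kp` — so the K5⁶ engine theorem quantifies
`∀ Reach ReachL LS Open` over THIS def by name and the rung instantiates (C5: one block, two files, zero token drift).  res-type-027 g20 pens the instances:
`HyperplaneLetters` (P's letter predicate verbatim), `OpeningCertKeyLetter` (the S10-shaped opening certificate: my Defs8 v2 (O) binder list with crit-2's B1 face
gauge / B2 order one / B3 `1 ≤ a`, + the PROMOTION certificate + crit-3 F1 output slots), and `PrefixReachKeyLetterP6 := PrefixReachKeyLetterParam … ReachTowerBTriplePrime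
(ReachTowerBQuintPrime ℙⁿ) (HyperplaneLetters …) (OpeningCertKeyLetter …)`; blob `IsoHypReachNDLeavesP6` as (K6-1P); inclusions `prefixReachKeyLetterP6_of_quint/_of_quad`,
★ `isoHypReachNDLeavesP6_of_P`, `isoHypReachNDLeavesP6_of_P5`, `not_isoHypReachNDLeavesP_of_not_P6` (the REPLACE lemma vs the REGISTERED hypothesis #22) — PURE LOGIC
(`Q₅ F ρ T := Q₆ F ρ T [] none`).  Customer of record: S10 (lead-1 R17-REPLAY: host `ℓh = Π`, face `ℓj = Λ`, `ℓs ∋ Y`; word P·CAR·[PROMOTE] inside the opening,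
then PAIR(E₁, St Λ) hosted by M♮ (tag), PAIR(St M, St S), PAIR(E_φ, St M), ND leaves).  OURS; NAMED HYPOTHESES, not statements of any manuscript; nothing of
[Hironaka2017] asserted; AI-written, weaker than expert review; resolution of singularities in positive characteristic is NOT proved here.
`--kind definition --supports stmt-ResolutionOfSingularities-20148 --as helper`.
-/

set_option linter.dupNamespace false
noncomputable section
open CategoryTheory CategoryTheory.Limits AlgebraicGeometry TopologicalSpace Topology IsLocalRing
open Literature.AlgebraicGeometry.Resolution
open AlgebraicGeometry.Scheme.IdealSheafData

namespace Summit.ResolutionOfSingularities.ResolutionOfSingularities.Cruxes.EquisingularLiftNat.Sections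

/-- **`PrefixReachKeyLetterParam k n H ι Reach ReachL LS Open F' ρ' T'`** — THE K5⁶ `hres` BLOCK (res-L1-w45b-stub-2 g16, text v1.1 df0014a1b76d223c VERBATIM + crit-2's arbitration l.≈83650: `Z.Infinite →` inserted after `¬ T₁ ⊆ Z →` in (ii)):
the lettered-prefix reach with the key-incidence tag, parametric in the reach slots `Reach`/`ReachL`, the letter predicate `LS` and the certified opening `Open`
exactly as the engine quantifies them.  See the module docstring for the clause list. [OURS · L1 W4.5b · named predicate, no mathematical content of its own] -/
def PrefixReachKeyLetterParam (k : Type) [Field k] [IsAlgClosed k] (n : ℕ) (H : AlgebraicGeometry.Scheme.{0})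
    (ι : H ⟶ (Literature.AlgebraicGeometry.Motives.projectiveSpace n k).left)
    (Reach : ∀ (F₁ F₂ : AlgebraicGeometry.Scheme.{0}), (F₂ ⟶ F₁) → F₁ → Set F₂ → ∀ (F₉ : AlgebraicGeometry.Scheme.{0}), (F₉ ⟶ F₂) → Set F₉ → Prop)
    (ReachL : ∀ (F₂ : AlgebraicGeometry.Scheme.{0}), (F₂ ⟶ (Literature.AlgebraicGeometry.Motives.projectiveSpace n k).left) →
      (Literature.AlgebraicGeometry.Motives.projectiveSpace n k).left → Set F₂ → List (Set F₂) → ∀ (F₉ : AlgebraicGeometry.Scheme.{0}), (F₉ ⟶ F₂) → Set F₉ → Prop)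
    (LS : ∀ (F₂ : AlgebraicGeometry.Scheme.{0}), (F₂ ⟶ (Literature.AlgebraicGeometry.Motives.projectiveSpace n k).left) →
      (Literature.AlgebraicGeometry.Motives.projectiveSpace n k).left → List (Set F₂) → Prop)
    (Open : ∀ (F₃ : AlgebraicGeometry.Scheme.{0}), (F₃ ⟶ (Literature.AlgebraicGeometry.Motives.projectiveSpace n k).left) → Set F₃ → List (Set F₃) →
      Option (Set F₃ × Set F₃ × Set F₃) → Prop)
    (F' : AlgebraicGeometry.Scheme.{0}) (ρ' : F' ⟶ (Literature.AlgebraicGeometry.Motives.projectiveSpace n k).left) (T' : Set F') : Prop :=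
  ∀ Q : (∀ F₁ : AlgebraicGeometry.Scheme.{0}, (F₁ ⟶ (Literature.AlgebraicGeometry.Motives.projectiveSpace n k).left) → Set F₁ → List (Set F₁) →
      Option (Set F₁ × Set F₁ × Set F₁) → Prop),
    -- (0) START: no letters, no tag
    Q (Literature.AlgebraicGeometry.Motives.projectiveSpace n k).left (𝟙 (Literature.AlgebraicGeometry.Motives.projectiveSpace n k).left) (Set.range ι) [] none →
    -- (D) DROP: forget listed letters (any sublist, as a set of names) and/or the tag
    (∀ (F₁ : AlgebraicGeometry.Scheme.{0}) (ρ : F₁ ⟶ (Literature.AlgebraicGeometry.Motives.projectiveSpace n k).left) (T₁ : Set F₁) (Ls Ls' : List (Set F₁))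
        (Kp Kp' : Option (Set F₁ × Set F₁ × Set F₁)),
      Q F₁ ρ T₁ Ls Kp → (∀ L ∈ Ls', L ∈ Ls) → (Kp' = Kp ∨ Kp' = none) → Q F₁ ρ T₁ Ls' Kp') →
    -- (Pc) K5′'s POINT STEP + `Reach`-moves (PrefixReachBQuadPrime's first clause), from ANY slots, letters and tag DROPPED
    (∀ (F₁ F₂ : AlgebraicGeometry.Scheme.{0}) (ρ : F₁ ⟶ (Literature.AlgebraicGeometry.Motives.projectiveSpace n k).left) (T₁ : Set F₁) (Ls : List (Set F₁))
        (Kp : Option (Set F₁ × Set F₁ × Set F₁))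
        (x : ↥(AlgebraicGeometry.Scheme.IdealSheafData.vanishingIdeal (⟨closure T₁, isClosed_closure⟩ : TopologicalSpace.Closeds F₁)).subscheme) (υ : F₂ ⟶ F₁)
        (hx : IsClosed ({((AlgebraicGeometry.Scheme.IdealSheafData.vanishingIdeal
          (⟨closure T₁, isClosed_closure⟩ : TopologicalSpace.Closeds F₁)).subschemeι x : F₁)} : Set F₁)), Q F₁ ρ T₁ Ls Kp →
      ¬ IsRegularLocalRing ((AlgebraicGeometry.Scheme.IdealSheafData.vanishingIdeal
          (⟨closure T₁, isClosed_closure⟩ : TopologicalSpace.Closeds F₁)).subscheme.presheaf.stalk x) →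
      IsRegularLocalRing (F₁.presheaf.stalk ((AlgebraicGeometry.Scheme.IdealSheafData.vanishingIdeal
          (⟨closure T₁, isClosed_closure⟩ : TopologicalSpace.Closeds F₁)).subschemeι x)) → Literature.AlgebraicGeometry.Resolution.IsBlowup υ
        (AlgebraicGeometry.Scheme.IdealSheafData.vanishingIdeal (⟨{((AlgebraicGeometry.Scheme.IdealSheafData.vanishingIdeal
            (⟨closure T₁, isClosed_closure⟩ : TopologicalSpace.Closeds F₁)).subschemeι x : F₁)}, hx⟩ : TopologicalSpace.Closeds F₁)) →
      Q F₂ (υ ≫ ρ) (closure (υ ⁻¹' (T₁ \ {((AlgebraicGeometry.Scheme.IdealSheafData.vanishingIdeal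
          (⟨closure T₁, isClosed_closure⟩ : TopologicalSpace.Closeds F₁)).subschemeι x : F₁)}))) [] none ∧ (∀ (F₉ : AlgebraicGeometry.Scheme.{0}) (β : F₉ ⟶ F₂) (T₉ : Set F₉),
        Reach F₁ F₂ υ ((AlgebraicGeometry.Scheme.IdealSheafData.vanishingIdeal (⟨closure T₁, isClosed_closure⟩ : TopologicalSpace.Closeds F₁)).subschemeι x)
          (closure (υ ⁻¹' (T₁ \ {((AlgebraicGeometry.Scheme.IdealSheafData.vanishingIdeal
            (⟨closure T₁, isClosed_closure⟩ : TopologicalSpace.Closeds F₁)).subschemeι x : F₁)}))) F₉ β T₉ → Q F₉ ((β ≫ υ) ≫ ρ) T₉ [] none)) →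
    -- (PL) A⁗: at the INITIAL stage only, LETTERED `ReachL`-towers after a good point step (PrefixReachBQuadPrime's second clause), conclusion at `[] none`
    (∀ (F₂ : AlgebraicGeometry.Scheme.{0}) (x₀ : ↥(AlgebraicGeometry.Scheme.IdealSheafData.vanishingIdeal
          (⟨closure (Set.range ι), isClosed_closure⟩ : TopologicalSpace.Closeds (Literature.AlgebraicGeometry.Motives.projectiveSpace n k).left)).subscheme)
        (υ : F₂ ⟶ (Literature.AlgebraicGeometry.Motives.projectiveSpace n k).left) (hx₀ : IsClosed ({((AlgebraicGeometry.Scheme.IdealSheafData.vanishingIdeal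
          (⟨closure (Set.range ι), isClosed_closure⟩ : TopologicalSpace.Closeds (Literature.AlgebraicGeometry.Motives.projectiveSpace n k).left)).subschemeι x₀ : (Literature.AlgebraicGeometry.Motives.projectiveSpace n k).left)} : Set (Literature.AlgebraicGeometry.Motives.projectiveSpace n k).left))
        (Ls₂ : List (Set F₂)), ¬ IsRegularLocalRing ((AlgebraicGeometry.Scheme.IdealSheafData.vanishingIdeal
          (⟨closure (Set.range ι), isClosed_closure⟩ : TopologicalSpace.Closeds (Literature.AlgebraicGeometry.Motives.projectiveSpace n k).left)).subscheme.presheaf.stalk x₀) →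
      IsRegularLocalRing ((Literature.AlgebraicGeometry.Motives.projectiveSpace n k).left.presheaf.stalk ((AlgebraicGeometry.Scheme.IdealSheafData.vanishingIdeal
          (⟨closure (Set.range ι), isClosed_closure⟩ : TopologicalSpace.Closeds (Literature.AlgebraicGeometry.Motives.projectiveSpace n k).left)).subschemeι x₀ : (Literature.AlgebraicGeometry.Motives.projectiveSpace n k).left)) →
      Literature.AlgebraicGeometry.Resolution.IsBlowup υ (AlgebraicGeometry.Scheme.IdealSheafData.vanishingIdeal (⟨{((AlgebraicGeometry.Scheme.IdealSheafData.vanishingIdeal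
          (⟨closure (Set.range ι), isClosed_closure⟩ : TopologicalSpace.Closeds (Literature.AlgebraicGeometry.Motives.projectiveSpace n k).left)).subschemeι x₀ : (Literature.AlgebraicGeometry.Motives.projectiveSpace n k).left)}, hx₀⟩ : TopologicalSpace.Closeds (Literature.AlgebraicGeometry.Motives.projectiveSpace n k).left)) →
      LS F₂ υ ((AlgebraicGeometry.Scheme.IdealSheafData.vanishingIdeal
          (⟨closure (Set.range ι), isClosed_closure⟩ : TopologicalSpace.Closeds (Literature.AlgebraicGeometry.Motives.projectiveSpace n k).left)).subschemeι x₀ : (Literature.AlgebraicGeometry.Motives.projectiveSpace n k).left) Ls₂ →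
      ∀ (F₉ : AlgebraicGeometry.Scheme.{0}) (β : F₉ ⟶ F₂) (T₉ : Set F₉), ReachL F₂ υ ((AlgebraicGeometry.Scheme.IdealSheafData.vanishingIdeal
          (⟨closure (Set.range ι), isClosed_closure⟩ : TopologicalSpace.Closeds (Literature.AlgebraicGeometry.Motives.projectiveSpace n k).left)).subschemeι x₀ : (Literature.AlgebraicGeometry.Motives.projectiveSpace n k).left) (closure (υ ⁻¹' (Set.range ι \ {((AlgebraicGeometry.Scheme.IdealSheafData.vanishingIdeal
          (⟨closure (Set.range ι), isClosed_closure⟩ : TopologicalSpace.Closeds (Literature.AlgebraicGeometry.Motives.projectiveSpace n k).left)).subschemeι x₀ : (Literature.AlgebraicGeometry.Motives.projectiveSpace n k).left)}))) Ls₂ F₉ β T₉ →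
        Q F₉ (β ≫ υ) T₉ [] none) →
    -- (i) LETTERED POINT STEP at a closed non-regular point of `T̃`, regular on `F`: at most ONE listed letter THROUGH the point (`Lt = some L`: nested section,
    --     `L̃` regular at the point), every other listed letter AWAY, the tag's three letters AWAY; letters `↦ St`, tag `↦ St`, optional birth of `E_x = υ⁻¹{x}`
    (∀ (F₁ F₂ : AlgebraicGeometry.Scheme.{0}) (ρ : F₁ ⟶ (Literature.AlgebraicGeometry.Motives.projectiveSpace n k).left) (T₁ : Set F₁) (Ls : List (Set F₁))
        (Kp : Option (Set F₁ × Set F₁ × Set F₁)) (Lt : Option (Set F₁))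
        (x : ↥(AlgebraicGeometry.Scheme.IdealSheafData.vanishingIdeal (⟨closure T₁, isClosed_closure⟩ : TopologicalSpace.Closeds F₁)).subscheme) (υ : F₂ ⟶ F₁)
        (hx : IsClosed ({((AlgebraicGeometry.Scheme.IdealSheafData.vanishingIdeal
          (⟨closure T₁, isClosed_closure⟩ : TopologicalSpace.Closeds F₁)).subschemeι x : F₁)} : Set F₁)), Q F₁ ρ T₁ Ls Kp →
      ¬ IsRegularLocalRing ((AlgebraicGeometry.Scheme.IdealSheafData.vanishingIdeal
          (⟨closure T₁, isClosed_closure⟩ : TopologicalSpace.Closeds F₁)).subscheme.presheaf.stalk x) →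
      IsRegularLocalRing (F₁.presheaf.stalk ((AlgebraicGeometry.Scheme.IdealSheafData.vanishingIdeal
          (⟨closure T₁, isClosed_closure⟩ : TopologicalSpace.Closeds F₁)).subschemeι x)) →
      (∀ L ∈ Ls, ((AlgebraicGeometry.Scheme.IdealSheafData.vanishingIdeal (⟨closure T₁, isClosed_closure⟩ : TopologicalSpace.Closeds F₁)).subschemeι x : F₁) ∈ closure L →
        Lt = some L) →
      (∀ L : Set F₁, Lt = some L → L ∈ Ls ∧ ∀ e : ↥(redSub F₁ (closure L) isClosed_closure), (redSubι F₁ (closure L) isClosed_closure e : F₁) =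
          ((AlgebraicGeometry.Scheme.IdealSheafData.vanishingIdeal (⟨closure T₁, isClosed_closure⟩ : TopologicalSpace.Closeds F₁)).subschemeι x : F₁) →
        IsRegularLocalRing ((redSub F₁ (closure L) isClosed_closure).presheaf.stalk e)) →
      (∀ K A C : Set F₁, Kp = some (K, A, C) →
        ((AlgebraicGeometry.Scheme.IdealSheafData.vanishingIdeal (⟨closure T₁, isClosed_closure⟩ : TopologicalSpace.Closeds F₁)).subschemeι x : F₁) ∉ closure K ∧
        ((AlgebraicGeometry.Scheme.IdealSheafData.vanishingIdeal (⟨closure T₁, isClosed_closure⟩ : TopologicalSpace.Closeds F₁)).subschemeι x : F₁) ∉ closure A ∧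
        ((AlgebraicGeometry.Scheme.IdealSheafData.vanishingIdeal (⟨closure T₁, isClosed_closure⟩ : TopologicalSpace.Closeds F₁)).subschemeι x : F₁) ∉ closure C) →
      Literature.AlgebraicGeometry.Resolution.IsBlowup υ
        (AlgebraicGeometry.Scheme.IdealSheafData.vanishingIdeal (⟨{((AlgebraicGeometry.Scheme.IdealSheafData.vanishingIdeal
            (⟨closure T₁, isClosed_closure⟩ : TopologicalSpace.Closeds F₁)).subschemeι x : F₁)}, hx⟩ : TopologicalSpace.Closeds F₁)) →
      ∀ Ls' : List (Set F₂),
        (Ls' = Ls.map (fun L => closure (υ ⁻¹' (L \ {((AlgebraicGeometry.Scheme.IdealSheafData.vanishingIdeal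
            (⟨closure T₁, isClosed_closure⟩ : TopologicalSpace.Closeds F₁)).subschemeι x : F₁)}))) ∨
         Ls' = Ls.map (fun L => closure (υ ⁻¹' (L \ {((AlgebraicGeometry.Scheme.IdealSheafData.vanishingIdeal
            (⟨closure T₁, isClosed_closure⟩ : TopologicalSpace.Closeds F₁)).subschemeι x : F₁)}))) ++
            [υ ⁻¹' {((AlgebraicGeometry.Scheme.IdealSheafData.vanishingIdeal (⟨closure T₁, isClosed_closure⟩ : TopologicalSpace.Closeds F₁)).subschemeι x : F₁)}]) →
        Q F₂ (υ ≫ ρ) (closure (υ ⁻¹' (T₁ \ {((AlgebraicGeometry.Scheme.IdealSheafData.vanishingIdeal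
            (⟨closure T₁, isClosed_closure⟩ : TopologicalSpace.Closeds F₁)).subschemeι x : F₁)}))) Ls'
          (Kp.map (fun t => (closure (υ ⁻¹' (t.1 \ {((AlgebraicGeometry.Scheme.IdealSheafData.vanishingIdeal
              (⟨closure T₁, isClosed_closure⟩ : TopologicalSpace.Closeds F₁)).subschemeι x : F₁)})),
            closure (υ ⁻¹' (t.2.1 \ {((AlgebraicGeometry.Scheme.IdealSheafData.vanishingIdeal
              (⟨closure T₁, isClosed_closure⟩ : TopologicalSpace.Closeds F₁)).subschemeι x : F₁)})),
            closure (υ ⁻¹' (t.2.2 \ {((AlgebraicGeometry.Scheme.IdealSheafData.vanishingIdeal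
              (⟨closure T₁, isClosed_closure⟩ : TopologicalSpace.Closeds F₁)).subschemeι x : F₁)})))))) →
    -- (O) CERTIFIED OPENING (opaque here; Defs8: `Open := OpeningCert k n H ι`, S10's «birth of M♮ + P(x₀) + CAR + PROMOTE» certificate list, text v1.1)
    (∀ (F₃ : AlgebraicGeometry.Scheme.{0}) (ρ₃ : F₃ ⟶ (Literature.AlgebraicGeometry.Motives.projectiveSpace n k).left) (T₃ : Set F₃) (Ls₃ : List (Set F₃))
        (Kp₃ : Option (Set F₃ × Set F₃ × Set F₃)), Open F₃ ρ₃ T₃ Ls₃ Kp₃ → Q F₃ ρ₃ T₃ Ls₃ Kp₃) →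
    -- (ii) PAIR ROUND at the transversal crossing curve `Z` of two listed letters `A ≠ B` (stage-level, (T-k)-free): `Z ⊆ T`, `T ⊄ Z`, `Z̃` regular, curve clause,
    --      `F` regular at the closed points of `Z`; the tag is absent or HOSTS (its pair is `{A, B}`, its key letter is listed and is not a member); every other
    --      listed letter does not contain `Z` and meets it transversally (possibly not at all); letters `↦ St`, tag consumed, optional birth of `E_Z = υ'⁻¹ Z`
    (∀ (F₁ F₃ : AlgebraicGeometry.Scheme.{0}) (ρ : F₁ ⟶ (Literature.AlgebraicGeometry.Motives.projectiveSpace n k).left) (T₁ : Set F₁) (Ls : List (Set F₁))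
        (Kp : Option (Set F₁ × Set F₁ × Set F₁)) (A B Z : Set F₁) (hZ : IsClosed Z) (υ' : F₃ ⟶ F₁),
      Q F₁ ρ T₁ Ls Kp → A ∈ Ls → B ∈ Ls → A ≠ B →
      AlgebraicGeometry.Scheme.IdealSheafData.vanishingIdeal (⟨closure A, isClosed_closure⟩ : TopologicalSpace.Closeds F₁) ⊔
          AlgebraicGeometry.Scheme.IdealSheafData.vanishingIdeal (⟨closure B, isClosed_closure⟩ : TopologicalSpace.Closeds F₁) =
        AlgebraicGeometry.Scheme.IdealSheafData.vanishingIdeal (⟨Z, hZ⟩ : TopologicalSpace.Closeds F₁) →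
      Z ⊆ T₁ → ¬ T₁ ⊆ Z → (∀ z : ↥(redSub F₁ Z hZ), IsRegularLocalRing ((redSub F₁ Z hZ).presheaf.stalk z)) →
      (∀ z : ↥(redSub F₁ Z hZ), IsClosed ({z} : Set ↥(redSub F₁ Z hZ)) → ringKrullDim ((redSub F₁ Z hZ).presheaf.stalk z) = ((1 : ℕ) : WithBot ℕ∞)) →
      (∀ z ∈ Z, IsClosed ({z} : Set F₁) → IsRegularLocalRing (F₁.presheaf.stalk z)) →
      (∀ K A' C' : Set F₁, Kp = some (K, A', C') → K ∈ Ls ∧ K ≠ A ∧ K ≠ B ∧ ((A' = A ∧ C' = B) ∨ (A' = B ∧ C' = A))) →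
      (∀ L ∈ Ls, L ≠ A → L ≠ B → (∀ K A' C' : Set F₁, Kp = some (K, A', C') → L ≠ K) →
        AlgebraicGeometry.Scheme.IdealSheafData.vanishingIdeal (⟨closure L, isClosed_closure⟩ : TopologicalSpace.Closeds F₁) ⊔
            AlgebraicGeometry.Scheme.IdealSheafData.vanishingIdeal (⟨Z, hZ⟩ : TopologicalSpace.Closeds F₁) =
          AlgebraicGeometry.Scheme.IdealSheafData.vanishingIdeal (⟨closure L ∩ Z, isClosed_closure.inter hZ⟩ : TopologicalSpace.Closeds F₁) ∧
        ∀ z ∈ Z, IsClosed ({z} : Set F₁) →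
          ¬ Literature.AlgebraicGeometry.Resolution.stalkIdeal (AlgebraicGeometry.Scheme.IdealSheafData.vanishingIdeal (⟨closure L, isClosed_closure⟩ : TopologicalSpace.Closeds F₁)) z ≤
            Literature.AlgebraicGeometry.Resolution.stalkIdeal (AlgebraicGeometry.Scheme.IdealSheafData.vanishingIdeal (⟨Z, hZ⟩ : TopologicalSpace.Closeds F₁)) z) →
      Literature.AlgebraicGeometry.Resolution.IsBlowup υ' (AlgebraicGeometry.Scheme.IdealSheafData.vanishingIdeal (⟨Z, hZ⟩ : TopologicalSpace.Closeds F₁)) →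
      ∀ Ls' : List (Set F₃),
        (Ls' = Ls.map (fun L => closure (υ' ⁻¹' (closure L \ Z))) ∨ Ls' = Ls.map (fun L => closure (υ' ⁻¹' (closure L \ Z))) ++ [υ' ⁻¹' Z]) →
        Q F₃ (υ' ≫ ρ) (closure (υ' ⁻¹' (T₁ \ Z))) Ls' none) →
    -- (HR) HOSTED ROUND₂ inside a listed host `E₁ ∈ Ls` (K5ʰ v2.2's stage-level clause VERBATIM: regular curve `Z ⊆ closure E₁ ∩ T`, `Ẽ` regular along `Z̃`,
    --      `DirStepUnobs` in the host, curve clause), every OTHER letter and the tag DROPPED: output `[St E₁] none` (supplier = ✓ `TCPlus.hround_seam` after projection)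
    (∀ (F₁ F₃ : AlgebraicGeometry.Scheme.{0}) (ρ : F₁ ⟶ (Literature.AlgebraicGeometry.Motives.projectiveSpace n k).left) (T₁ : Set F₁) (Ls : List (Set F₁))
        (Kp : Option (Set F₁ × Set F₁ × Set F₁)) (E₁ : Set F₁) (Z : Set F₁) (hZ : IsClosed Z) (υ' : F₃ ⟶ F₁),
      Q F₁ ρ T₁ Ls Kp → E₁ ∈ Ls → Z ⊆ closure E₁ → Z ⊆ T₁ → ¬ T₁ ⊆ Z → (∀ z : ↥(redSub F₁ Z hZ), IsRegularLocalRing ((redSub F₁ Z hZ).presheaf.stalk z)) →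
      (∀ (i : redSub F₁ Z hZ ⟶ redSub F₁ (closure E₁) isClosed_closure), i ≫ redSubι F₁ (closure E₁) isClosed_closure = redSubι F₁ Z hZ →
        ∀ z : ↥(redSub F₁ Z hZ), IsRegularLocalRing ((redSub F₁ (closure E₁) isClosed_closure).presheaf.stalk (i z))) → DirStepUnobs F₁ (closure E₁) isClosed_closure Z hZ →
      (∀ z : ↥(redSub F₁ Z hZ), IsClosed ({z} : Set ↥(redSub F₁ Z hZ)) → ringKrullDim ((redSub F₁ Z hZ).presheaf.stalk z) = ((1 : ℕ) : WithBot ℕ∞)) →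
      Literature.AlgebraicGeometry.Resolution.IsBlowup υ' (AlgebraicGeometry.Scheme.IdealSheafData.vanishingIdeal (⟨Z, hZ⟩ : TopologicalSpace.Closeds F₁)) →
      Q F₃ (υ' ≫ ρ) (closure (υ' ⁻¹' (T₁ \ Z))) [closure (υ' ⁻¹' (closure E₁ \ Z))] none) →
    -- END (C3): the final slots are existential
    ∃ (Ls : List (Set F')) (Kp : Option (Set F' × Set F' × Set F')), Q F' ρ' T' Ls Kp

/-- **`HyperplaneLetters k n H ι F₂ υ p Ls₂`** — the hyperplane-letter predicate of `PrefixReachBQuadPrime`'s second clause VERBATIM (the point spelled `p`):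
every `L ∈ Ls₂` is the strict transform `closure (υ⁻¹(V₊(ℓ) ∖ {p}))` of a hyperplane `V₊(ℓ) ∋ p` with `H ⊄ V₊(ℓ)`; instantiates the engine's `LS` slot.
[OURS · named predicate, no mathematical content of its own] -/
def HyperplaneLetters (k : Type) [Field k] [IsAlgClosed k] (n : ℕ) (H : AlgebraicGeometry.Scheme.{0})
    (ι : H ⟶ (Literature.AlgebraicGeometry.Motives.projectiveSpace n k).left) (F₂ : AlgebraicGeometry.Scheme.{0}) (υ : F₂ ⟶ (Literature.AlgebraicGeometry.Motives.projectiveSpace n k).left) (p : (Literature.AlgebraicGeometry.Motives.projectiveSpace n k).left) (Ls₂ : List (Set F₂)) : Prop :=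
  letI := MvPolynomial.gradedAlgebra (σ := Fin (n + 1)) (R := k); ∀ L ∈ Ls₂, ∃ ℓ : MvPolynomial (Fin (n + 1)) k, ℓ.IsHomogeneous 1 ∧ ℓ ≠ 0 ∧ p ∈ {y : (Literature.AlgebraicGeometry.Motives.projectiveSpace n k).left | ℓ ∈ (y : ProjectiveSpectrum (MvPolynomial.homogeneousSubmodule (Fin (n + 1)) k)).asHomogeneousIdeal} ∧ ¬ (Set.range ι ⊆ {y : (Literature.AlgebraicGeometry.Motives.projectiveSpace n k).left | ℓ ∈ (y : ProjectiveSpectrum (MvPolynomial.homogeneousSubmodule (Fin (n + 1)) k)).asHomogeneousIdeal}) ∧ L = closure (υ ⁻¹' ({y : (Literature.AlgebraicGeometry.Motives.projectiveSpace n k).left | ℓ ∈ (y : ProjectiveSpectrum (MvPolynomial.homogeneousSubmodule (Fin (n + 1)) k)).asHomogeneousIdeal} \ {p}))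

/-- **`OpeningCertKeyLetter k n H ι F₃ ρ₃ T₃ Ls₃ Kp₃`** — the S10-shaped OPENING CERTIFICATE instantiating the engine's opaque `Open` slot (desk R55):
hyperplane letters `ℓh` (host), `ℓj` (face), `ℓs` (others) through the closed non-regular point `x₀`, off `H`; the key form `G` (homogeneous of degree `e`,
multiplicity `a ≥ 2` at `x₀` — res-L1-w45b-stub-2 (A1): the tag is true upstairs iff `a ≥ 2`) in the TERMWISE-LIFTABLE gauge `G = ℓh^a·U + ℓh·R₁ + R₂·ℓj`, `R₁, R₂ ∈ 𝔭_{x₀}^a`, `U ∉ 𝔭_{x₀}`, `H ⊄ V₊(G)` (crit-2 B1); the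
point step `υ` at `x₀`; the CARRIER `Z = E_{x₀} ∩ St V₊(ℓh)` (legal, infinite, curve clause, `Z̃` regular) with the strict transform of the key letter of
generic ORDER ONE along it (Δ2b ✓ p666982's downstairs `hgen` at `a' = 1`, crit-2 B2), the other letters not containing `Z` and meeting it transversally ((ii)'s currency, (A5)); the REDUCED-TRACE certificate (A2: chartwise radical
dehomogenisations of `G`), ambient regularity at `x₀` and along `Z` (A3), the transversality of `(E_{x₀}, St V₊(ℓh))` (A4); the carrier round `υ'`; the PROMOTION certificate «`(St_Z St_{x₀} V₊(G))~` regular»; and the OUTPUT SLOTS pinned (crit-3 F1): `ρ₃ = (υ' ≫ υ) ≫ 𝟙`,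
`T₃ = St_Z St_{x₀} (range ι)`, `Ls₃ ⊆` the transformed letters `++ [St_Z E_{x₀}, υ'⁻¹ Z, St_Z St_{x₀} V₊(G)]` containing the promoted key letter, and the TAG
`Kp₃ = some (St_Z St_{x₀} V₊(G), υ'⁻¹ Z, St_Z St_{x₀} V₊(ℓj))` («the key letter contains the crossing curve of `E₁` and `St² ℓj`» — S10's φ_q).
Supplier (upstairs, not here): HOPEN = H3 ✓ p634308 + K5′ point step + Δ2a ✓ p665994 + pair centre + HT2′ ✓ p661346 + Δ2b ✓ p666982 + G1 + D5-3.
[OURS · L1 W4.5b · named certificate predicate, no mathematical content of its own] -/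
def OpeningCertKeyLetter (k : Type) [Field k] [IsAlgClosed k] (n : ℕ) (H : AlgebraicGeometry.Scheme.{0})
    (ι : H ⟶ (Literature.AlgebraicGeometry.Motives.projectiveSpace n k).left) (F₃ : AlgebraicGeometry.Scheme.{0}) (ρ₃ : F₃ ⟶ (Literature.AlgebraicGeometry.Motives.projectiveSpace n k).left) (T₃ : Set F₃) (Ls₃ : List (Set F₃))
    (Kp₃ : Option (Set F₃ × Set F₃ × Set F₃)) : Prop :=
  letI := MvPolynomial.gradedAlgebra (σ := Fin (n + 1)) (R := k)
  ∃ (F₂ : AlgebraicGeometry.Scheme.{0})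
    (x₀ : ↥(vanishingIdeal (⟨closure (Set.range ι), isClosed_closure⟩ : Closeds (Literature.AlgebraicGeometry.Motives.projectiveSpace n k).left)).subscheme)
    (υ : F₂ ⟶ (Literature.AlgebraicGeometry.Motives.projectiveSpace n k).left) (hx₀ : IsClosed ({((vanishingIdeal (⟨closure (Set.range ι), isClosed_closure⟩ : Closeds (Literature.AlgebraicGeometry.Motives.projectiveSpace n k).left)).subschemeι x₀ : (Literature.AlgebraicGeometry.Motives.projectiveSpace n k).left)} : Set (Literature.AlgebraicGeometry.Motives.projectiveSpace n k).left))
    (ℓh ℓj : MvPolynomial (Fin (n + 1)) k) (ℓs : List (MvPolynomial (Fin (n + 1)) k)) (G U R₁ R₂ : MvPolynomial (Fin (n + 1)) k) (e a : ℕ)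
    (υ' : F₃ ⟶ F₂) (hZ : IsClosed (υ ⁻¹' {((vanishingIdeal (⟨closure (Set.range ι), isClosed_closure⟩ : Closeds (Literature.AlgebraicGeometry.Motives.projectiveSpace n k).left)).subschemeι x₀ : (Literature.AlgebraicGeometry.Motives.projectiveSpace n k).left)} ∩ closure (υ ⁻¹' ({y : (Literature.AlgebraicGeometry.Motives.projectiveSpace n k).left | ℓh ∈ (y : ProjectiveSpectrum (MvPolynomial.homogeneousSubmodule (Fin (n + 1)) k)).asHomogeneousIdeal} \ {((vanishingIdeal (⟨closure (Set.range ι), isClosed_closure⟩ : Closeds (Literature.AlgebraicGeometry.Motives.projectiveSpace n k).left)).subschemeι x₀ : (Literature.AlgebraicGeometry.Motives.projectiveSpace n k).left)})))),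
    -- `x₀` is a non-regular point of the reduced closure of `range ι`
    ¬ IsRegularLocalRing ((vanishingIdeal (⟨closure (Set.range ι), isClosed_closure⟩ : Closeds (Literature.AlgebraicGeometry.Motives.projectiveSpace n k).left)).subscheme.presheaf.stalk x₀) ∧
    -- the hyperplane letters through `x₀`, off `H`
    (∀ ℓ ∈ ℓh :: ℓj :: ℓs, ℓ.IsHomogeneous 1 ∧ ℓ ≠ 0 ∧ ((vanishingIdeal (⟨closure (Set.range ι), isClosed_closure⟩ : Closeds (Literature.AlgebraicGeometry.Motives.projectiveSpace n k).left)).subschemeι x₀ : (Literature.AlgebraicGeometry.Motives.projectiveSpace n k).left) ∈ {y : (Literature.AlgebraicGeometry.Motives.projectiveSpace n k).left | ℓ ∈ (y : ProjectiveSpectrum (MvPolynomial.homogeneousSubmodule (Fin (n + 1)) k)).asHomogeneousIdeal} ∧ ¬ (Set.range ι ⊆ {y : (Literature.AlgebraicGeometry.Motives.projectiveSpace n k).left | ℓ ∈ (y : ProjectiveSpectrum (MvPolynomial.homogeneousSubmodule (Fin (n + 1)) k)).asHomogeneousIdeal})) ∧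
    -- the key form in the (host, face) gauge
    G.IsHomogeneous e ∧ 2 ≤ a ∧ G = ℓh ^ a * U + ℓh * R₁ + R₂ * ℓj ∧ R₁ ∈ ((((vanishingIdeal (⟨closure (Set.range ι), isClosed_closure⟩ : Closeds (Literature.AlgebraicGeometry.Motives.projectiveSpace n k).left)).subschemeι x₀ : (Literature.AlgebraicGeometry.Motives.projectiveSpace n k).left) : ProjectiveSpectrum (MvPolynomial.homogeneousSubmodule (Fin (n + 1)) k)).asHomogeneousIdeal).toIdeal ^ a ∧ R₂ ∈ ((((vanishingIdeal (⟨closure (Set.range ι), isClosed_closure⟩ : Closeds (Literature.AlgebraicGeometry.Motives.projectiveSpace n k).left)).subschemeι x₀ : (Literature.AlgebraicGeometry.Motives.projectiveSpace n k).left) : ProjectiveSpectrum (MvPolynomial.homogeneousSubmodule (Fin (n + 1)) k)).asHomogeneousIdeal).toIdeal ^ a ∧ U ∉ (((vanishingIdeal (⟨closure (Set.range ι), isClosed_closure⟩ : Closeds (Literature.AlgebraicGeometry.Motives.projectiveSpace n k).left)).subschemeι x₀ : (Literature.AlgebraicGeometry.Motives.projectiveSpace n k).left) : ProjectiveSpectrum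 (MvPolynomial.homogeneousSubmodule (Fin (n + 1)) k)).asHomogeneousIdeal ∧
    ¬ (Set.range ι ⊆ {y : (Literature.AlgebraicGeometry.Motives.projectiveSpace n k).left | G ∈ (y : ProjectiveSpectrum (MvPolynomial.homogeneousSubmodule (Fin (n + 1)) k)).asHomogeneousIdeal}) ∧
    -- (A2) REDUCED TRACE of the key letter: on every standard chart the dehomogenised key form generates a radical ideal
    (∀ i : Fin (n + 1), (Ideal.span {MvPolynomial.aeval (Function.update MvPolynomial.X i (1 : MvPolynomial (Fin (n + 1)) k)) G}).IsRadical) ∧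
    -- (A3) the ambient is regular at `x₀`
    IsRegularLocalRing ((Literature.AlgebraicGeometry.Motives.projectiveSpace n k).left.presheaf.stalk ((vanishingIdeal (⟨closure (Set.range ι), isClosed_closure⟩ : Closeds (Literature.AlgebraicGeometry.Motives.projectiveSpace n k).left)).subschemeι x₀ : (Literature.AlgebraicGeometry.Motives.projectiveSpace n k).left)) ∧
    -- the point step at `x₀`
    IsBlowup υ (vanishingIdeal (⟨{((vanishingIdeal (⟨closure (Set.range ι), isClosed_closure⟩ : Closeds (Literature.AlgebraicGeometry.Motives.projectiveSpace n k).left)).subschemeι x₀ : (Literature.AlgebraicGeometry.Motives.projectiveSpace n k).left)}, hx₀⟩ : Closeds (Literature.AlgebraicGeometry.Motives.projectiveSpace n k).left)) ∧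
    -- the carrier `Z = E_{x₀} ∩ St V₊(ℓh)`
    (υ ⁻¹' {((vanishingIdeal (⟨closure (Set.range ι), isClosed_closure⟩ : Closeds (Literature.AlgebraicGeometry.Motives.projectiveSpace n k).left)).subschemeι x₀ : (Literature.AlgebraicGeometry.Motives.projectiveSpace n k).left)} ∩ closure (υ ⁻¹' ({y : (Literature.AlgebraicGeometry.Motives.projectiveSpace n k).left | ℓh ∈ (y : ProjectiveSpectrum (MvPolynomial.homogeneousSubmodule (Fin (n + 1)) k)).asHomogeneousIdeal} \ {((vanishingIdeal (⟨closure (Set.range ι), isClosed_closure⟩ : Closeds (Literature.AlgebraicGeometry.Motives.projectiveSpace n k).left)).subschemeι x₀ : (Literature.AlgebraicGeometry.Motives.projectiveSpace n k).left)}))) ⊆ closure (υ ⁻¹' (Set.range ι \ {((vanishingIdeal (⟨closure (Set.range ι), isClosed_closure⟩ : Closeds (Literature.AlgebraicGeometry.Motives.projectiveSpace n k).left)).subschemeι x₀ : (Literature.AlgebraicGeometry.Motives.projectiveSpace n k).left)})) ∧ ¬ (closure (υ ⁻¹' (Set.range ι \ {((vanishingIdeal (⟨closure (Set.range ι), isClosed_closure⟩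 : Closeds (Literature.AlgebraicGeometry.Motives.projectiveSpace n k).left)).subschemeι x₀ : (Literature.AlgebraicGeometry.Motives.projectiveSpace n k).left)})) ⊆ (υ ⁻¹' {((vanishingIdeal (⟨closure (Set.range ι), isClosed_closure⟩ : Closeds (Literature.AlgebraicGeometry.Motives.projectiveSpace n k).left)).subschemeι x₀ : (Literature.AlgebraicGeometry.Motives.projectiveSpace n k).left)} ∩ closure (υ ⁻¹' ({y : (Literature.AlgebraicGeometry.Motives.projectiveSpace n k).left | ℓh ∈ (y : ProjectiveSpectrum (MvPolynomial.homogeneousSubmodule (Fin (n + 1)) k)).asHomogeneousIdeal} \ {((vanishingIdeal (⟨closure (Set.range ι), isClosed_closure⟩ : Closeds (Literature.AlgebraicGeometry.Motives.projectiveSpace n k).left)).subschemeι x₀ : (Literature.AlgebraicGeometry.Motives.projectiveSpace n k).left)})))) ∧ ((υ ⁻¹' {((vanishingIdeal (⟨closure (Set.range ι), isClosed_closure⟩ : Closeds (Literature.AlgebraicGeometry.Motives.projectiveSpace n k).left)).subschemeι x₀ : (Literature.AlgebraicGeometry.Motives.projectiveSpace n k).left)} ∩ closure (υ ⁻¹'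 ({y : (Literature.AlgebraicGeometry.Motives.projectiveSpace n k).left | ℓh ∈ (y : ProjectiveSpectrum (MvPolynomial.homogeneousSubmodule (Fin (n + 1)) k)).asHomogeneousIdeal} \ {((vanishingIdeal (⟨closure (Set.range ι), isClosed_closure⟩ : Closeds (Literature.AlgebraicGeometry.Motives.projectiveSpace n k).left)).subschemeι x₀ : (Literature.AlgebraicGeometry.Motives.projectiveSpace n k).left)})))).Infinite ∧
    (∀ z : ↥(redSub F₂ _ hZ), IsClosed ({z} : Set ↥(redSub F₂ _ hZ)) → ringKrullDim ((redSub F₂ _ hZ).presheaf.stalk z) = ((1 : ℕ) : WithBot ℕ∞)) ∧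
    (∀ z : ↥(redSub F₂ _ hZ), IsRegularLocalRing ((redSub F₂ _ hZ).presheaf.stalk z)) ∧
    -- (A3) `F₂` regular at the closed points of `Z`; (A4) the carrier is the TRANSVERSAL crossing of `E_{x₀}` and `St V₊(ℓh)`
    (∀ z ∈ (υ ⁻¹' {((vanishingIdeal (⟨closure (Set.range ι), isClosed_closure⟩ : Closeds (Literature.AlgebraicGeometry.Motives.projectiveSpace n k).left)).subschemeι x₀ : (Literature.AlgebraicGeometry.Motives.projectiveSpace n k).left)} ∩ closure (υ ⁻¹' ({y : (Literature.AlgebraicGeometry.Motives.projectiveSpace n k).left | ℓh ∈ (y : ProjectiveSpectrum (MvPolynomial.homogeneousSubmodule (Fin (n + 1)) k)).asHomogeneousIdeal} \ {((vanishingIdeal (⟨closure (Set.range ι), isClosed_closure⟩ : Closeds (Literature.AlgebraicGeometry.Motives.projectiveSpace n k).left)).subschemeι x₀ : (Literature.AlgebraicGeometry.Motives.projectiveSpace n k).left)}))), IsClosed ({z} : Set F₂) → IsRegularLocalRing (F₂.presheaf.stalk z)) ∧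
    vanishingIdeal (⟨υ ⁻¹' {((vanishingIdeal (⟨closure (Set.range ι), isClosed_closure⟩ : Closeds (Literature.AlgebraicGeometry.Motives.projectiveSpace n k).left)).subschemeι x₀ : (Literature.AlgebraicGeometry.Motives.projectiveSpace n k).left)}, hx₀.preimage υ.continuous⟩ : Closeds F₂) ⊔ vanishingIdeal (⟨closure (υ ⁻¹' ({y : (Literature.AlgebraicGeometry.Motives.projectiveSpace n k).left | ℓh ∈ (y : ProjectiveSpectrum (MvPolynomial.homogeneousSubmodule (Fin (n + 1)) k)).asHomogeneousIdeal} \ {((vanishingIdeal (⟨closure (Set.range ι), isClosed_closure⟩ : Closeds (Literature.AlgebraicGeometry.Motives.projectiveSpace n k).left)).subschemeι x₀ : (Literature.AlgebraicGeometry.Motives.projectiveSpace n k).left)})), isClosed_closure⟩ : Closeds F₂) =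
      vanishingIdeal (⟨_, hZ⟩ : Closeds F₂) ∧
    -- generic ORDER ONE of the strict transform of the key letter along `Z`
    (∀ z ∈ (υ ⁻¹' {((vanishingIdeal (⟨closure (Set.range ι), isClosed_closure⟩ : Closeds (Literature.AlgebraicGeometry.Motives.projectiveSpace n k).left)).subschemeι x₀ : (Literature.AlgebraicGeometry.Motives.projectiveSpace n k).left)} ∩ closure (υ ⁻¹' ({y : (Literature.AlgebraicGeometry.Motives.projectiveSpace n k).left | ℓh ∈ (y : ProjectiveSpectrum (MvPolynomial.homogeneousSubmodule (Fin (n + 1)) k)).asHomogeneousIdeal} \ {((vanishingIdeal (⟨closure (Set.range ι), isClosed_closure⟩ : Closeds (Literature.AlgebraicGeometry.Motives.projectiveSpace n k).left)).subschemeι x₀ : (Literature.AlgebraicGeometry.Motives.projectiveSpace n k).left)}))), IsClosed ({z} : Set F₂) →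
      ¬ stalkIdeal (vanishingIdeal (⟨closure (υ ⁻¹' ({y : (Literature.AlgebraicGeometry.Motives.projectiveSpace n k).left | G ∈ (y : ProjectiveSpectrum (MvPolynomial.homogeneousSubmodule (Fin (n + 1)) k)).asHomogeneousIdeal} \ {((vanishingIdeal (⟨closure (Set.range ι), isClosed_closure⟩ : Closeds (Literature.AlgebraicGeometry.Motives.projectiveSpace n k).left)).subschemeι x₀ : (Literature.AlgebraicGeometry.Motives.projectiveSpace n k).left)})), isClosed_closure⟩ : Closeds F₂)) z ≤ stalkIdeal (vanishingIdeal (⟨_, hZ⟩ : Closeds F₂)) z ^ 2) ∧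
    -- the other letters (face letter included) do not contain `Z` and meet it transversally, possibly not at all ((ii)'s crossed-letter currency, stub-2 (A5))
    (∀ ℓ ∈ ℓj :: ℓs,
      vanishingIdeal (⟨closure (υ ⁻¹' ({y : (Literature.AlgebraicGeometry.Motives.projectiveSpace n k).left | ℓ ∈ (y : ProjectiveSpectrum (MvPolynomial.homogeneousSubmodule (Fin (n + 1)) k)).asHomogeneousIdeal} \ {((vanishingIdeal (⟨closure (Set.range ι), isClosed_closure⟩ : Closeds (Literature.AlgebraicGeometry.Motives.projectiveSpace n k).left)).subschemeι x₀ : (Literature.AlgebraicGeometry.Motives.projectiveSpace n k).left)})), isClosed_closure⟩ : Closeds F₂) ⊔ vanishingIdeal (⟨_, hZ⟩ : Closeds F₂) =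
        vanishingIdeal (⟨closure (υ ⁻¹' ({y : (Literature.AlgebraicGeometry.Motives.projectiveSpace n k).left | ℓ ∈ (y : ProjectiveSpectrum (MvPolynomial.homogeneousSubmodule (Fin (n + 1)) k)).asHomogeneousIdeal} \ {((vanishingIdeal (⟨closure (Set.range ι), isClosed_closure⟩ : Closeds (Literature.AlgebraicGeometry.Motives.projectiveSpace n k).left)).subschemeι x₀ : (Literature.AlgebraicGeometry.Motives.projectiveSpace n k).left)})) ∩ (υ ⁻¹' {((vanishingIdeal (⟨closure (Set.range ι), isClosed_closure⟩ : Closeds (Literature.AlgebraicGeometry.Motives.projectiveSpace n k).left)).subschemeι x₀ : (Literature.AlgebraicGeometry.Motives.projectiveSpace n k).left)} ∩ closure (υ ⁻¹' ({y : (Literature.AlgebraicGeometry.Motives.projectiveSpace n k).left | ℓh ∈ (y : ProjectiveSpectrum (MvPolynomial.homogeneousSubmodule (Fin (n + 1)) k)).asHomogeneousIdeal} \ {((vanishingIdeal (⟨closure (Set.range ι), isClosed_closure⟩ : Closeds (Literature.AlgebraicGeometry.Motives.projectiveSpace n k).left)).subschemeι x₀ : (Literature.AlgebraicGeometry.Motives.projectiveSpace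 n k).left)}))), isClosed_closure.inter hZ⟩ : Closeds F₂) ∧
      ∀ z ∈ (υ ⁻¹' {((vanishingIdeal (⟨closure (Set.range ι), isClosed_closure⟩ : Closeds (Literature.AlgebraicGeometry.Motives.projectiveSpace n k).left)).subschemeι x₀ : (Literature.AlgebraicGeometry.Motives.projectiveSpace n k).left)} ∩ closure (υ ⁻¹' ({y : (Literature.AlgebraicGeometry.Motives.projectiveSpace n k).left | ℓh ∈ (y : ProjectiveSpectrum (MvPolynomial.homogeneousSubmodule (Fin (n + 1)) k)).asHomogeneousIdeal} \ {((vanishingIdeal (⟨closure (Set.range ι), isClosed_closure⟩ : Closeds (Literature.AlgebraicGeometry.Motives.projectiveSpace n k).left)).subschemeι x₀ : (Literature.AlgebraicGeometry.Motives.projectiveSpace n k).left)}))), IsClosed ({z} : Set F₂) →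
        ¬ stalkIdeal (vanishingIdeal (⟨closure (υ ⁻¹' ({y : (Literature.AlgebraicGeometry.Motives.projectiveSpace n k).left | ℓ ∈ (y : ProjectiveSpectrum (MvPolynomial.homogeneousSubmodule (Fin (n + 1)) k)).asHomogeneousIdeal} \ {((vanishingIdeal (⟨closure (Set.range ι), isClosed_closure⟩ : Closeds (Literature.AlgebraicGeometry.Motives.projectiveSpace n k).left)).subschemeι x₀ : (Literature.AlgebraicGeometry.Motives.projectiveSpace n k).left)})), isClosed_closure⟩ : Closeds F₂)) z ≤ stalkIdeal (vanishingIdeal (⟨_, hZ⟩ : Closeds F₂)) z) ∧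
    -- the carrier round
    IsBlowup υ' (vanishingIdeal (⟨_, hZ⟩ : Closeds F₂)) ∧
    -- PROMOTION certificate: the twice-transformed key letter is regular
    Literature.AlgebraicGeometry.Resolution.Scheme.IsRegular (redSub F₃ (closure (closure (υ' ⁻¹' (closure (υ ⁻¹' ({y : (Literature.AlgebraicGeometry.Motives.projectiveSpace n k).left | G ∈ (y : ProjectiveSpectrum (MvPolynomial.homogeneousSubmodule (Fin (n + 1)) k)).asHomogeneousIdeal} \ {((vanishingIdeal (⟨closure (Set.range ι), isClosed_closure⟩ : Closeds (Literature.AlgebraicGeometry.Motives.projectiveSpace n k).left)).subschemeι x₀ : (Literature.AlgebraicGeometry.Motives.projectiveSpace n k).left)})) \ (υ ⁻¹' {((vanishingIdeal (⟨closure (Set.range ι), isClosed_closure⟩ : Closeds (Literature.AlgebraicGeometry.Motives.projectiveSpace n k).left)).subschemeι x₀ : (Literature.AlgebraicGeometry.Motives.projectiveSpace n k).left)} ∩ closure (υ ⁻¹' ({y : (Literature.AlgebraicGeometry.Motives.projectiveSpace n k).left | ℓh ∈ (y : ProjectiveSpectrum (MvPolynomial.homogeneousSubmodule (Fin (n + 1))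 k)).asHomogeneousIdeal} \ {((vanishingIdeal (⟨closure (Set.range ι), isClosed_closure⟩ : Closeds (Literature.AlgebraicGeometry.Motives.projectiveSpace n k).left)).subschemeι x₀ : (Literature.AlgebraicGeometry.Motives.projectiveSpace n k).left)}))))))) isClosed_closure) ∧
    -- OUTPUT SLOTS
    ρ₃ = (υ' ≫ υ) ≫ 𝟙 _ ∧ T₃ = closure (υ' ⁻¹' (closure (υ ⁻¹' (Set.range ι \ {((vanishingIdeal (⟨closure (Set.range ι), isClosed_closure⟩ : Closeds (Literature.AlgebraicGeometry.Motives.projectiveSpace n k).left)).subschemeι x₀ : (Literature.AlgebraicGeometry.Motives.projectiveSpace n k).left)})) \ (υ ⁻¹' {((vanishingIdeal (⟨closure (Set.range ι), isClosed_closure⟩ : Closeds (Literature.AlgebraicGeometry.Motives.projectiveSpace n k).left)).subschemeι x₀ : (Literature.AlgebraicGeometry.Motives.projectiveSpace n k).left)} ∩ closure (υ ⁻¹' ({y : (Literature.AlgebraicGeometry.Motives.projectiveSpace n k).left | ℓh ∈ (y : ProjectiveSpectrum (MvPolynomial.homogeneousSubmodule (Fin (n + 1)) k)).asHomogeneousIdeal}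 \ {((vanishingIdeal (⟨closure (Set.range ι), isClosed_closure⟩ : Closeds (Literature.AlgebraicGeometry.Motives.projectiveSpace n k).left)).subschemeι x₀ : (Literature.AlgebraicGeometry.Motives.projectiveSpace n k).left)}))))) ∧
    (∀ L ∈ Ls₃, L ∈ (ℓh :: ℓj :: ℓs).map (fun ℓ => closure (υ' ⁻¹' (closure (υ ⁻¹' ({y : (Literature.AlgebraicGeometry.Motives.projectiveSpace n k).left | ℓ ∈ (y : ProjectiveSpectrum (MvPolynomial.homogeneousSubmodule (Fin (n + 1)) k)).asHomogeneousIdeal} \ {((vanishingIdeal (⟨closure (Set.range ι), isClosed_closure⟩ : Closeds (Literature.AlgebraicGeometry.Motives.projectiveSpace n k).left)).subschemeι x₀ : (Literature.AlgebraicGeometry.Motives.projectiveSpace n k).left)})) \ (υ ⁻¹' {((vanishingIdeal (⟨closure (Set.range ι), isClosed_closure⟩ : Closeds (Literature.AlgebraicGeometry.Motives.projectiveSpace n k).left)).subschemeι x₀ : (Literature.AlgebraicGeometry.Motives.projectiveSpace n k).left)} ∩ closure (υ ⁻¹' ({y : (Literature.AlgebraicGeometry.Motives.projectiveSpace n k).left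 | ℓh ∈ (y : ProjectiveSpectrum (MvPolynomial.homogeneousSubmodule (Fin (n + 1)) k)).asHomogeneousIdeal} \ {((vanishingIdeal (⟨closure (Set.range ι), isClosed_closure⟩ : Closeds (Literature.AlgebraicGeometry.Motives.projectiveSpace n k).left)).subschemeι x₀ : (Literature.AlgebraicGeometry.Motives.projectiveSpace n k).left)})))))) ++ [closure (υ' ⁻¹' (υ ⁻¹' {((vanishingIdeal (⟨closure (Set.range ι), isClosed_closure⟩ : Closeds (Literature.AlgebraicGeometry.Motives.projectiveSpace n k).left)).subschemeι x₀ : (Literature.AlgebraicGeometry.Motives.projectiveSpace n k).left)} \ (υ ⁻¹' {((vanishingIdeal (⟨closure (Set.range ι), isClosed_closure⟩ : Closeds (Literature.AlgebraicGeometry.Motives.projectiveSpace n k).left)).subschemeι x₀ : (Literature.AlgebraicGeometry.Motives.projectiveSpace n k).left)} ∩ closure (υ ⁻¹' ({y : (Literature.AlgebraicGeometry.Motives.projectiveSpace n k).left | ℓh ∈ (y : ProjectiveSpectrum (MvPolynomial.homogeneousSubmodule (Fin (n + 1)) k)).asHomogeneousIdeal} \ {((vanishingIdeal (⟨closure (Set.range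 ι), isClosed_closure⟩ : Closeds (Literature.AlgebraicGeometry.Motives.projectiveSpace n k).left)).subschemeι x₀ : (Literature.AlgebraicGeometry.Motives.projectiveSpace n k).left)}))))), υ' ⁻¹' (υ ⁻¹' {((vanishingIdeal (⟨closure (Set.range ι), isClosed_closure⟩ : Closeds (Literature.AlgebraicGeometry.Motives.projectiveSpace n k).left)).subschemeι x₀ : (Literature.AlgebraicGeometry.Motives.projectiveSpace n k).left)} ∩ closure (υ ⁻¹' ({y : (Literature.AlgebraicGeometry.Motives.projectiveSpace n k).left | ℓh ∈ (y : ProjectiveSpectrum (MvPolynomial.homogeneousSubmodule (Fin (n + 1)) k)).asHomogeneousIdeal} \ {((vanishingIdeal (⟨closure (Set.range ι), isClosed_closure⟩ : Closeds (Literature.AlgebraicGeometry.Motives.projectiveSpace n k).left)).subschemeι x₀ : (Literature.AlgebraicGeometry.Motives.projectiveSpace n k).left)}))), closure (υ' ⁻¹' (closure (υ ⁻¹' ({y : (Literature.AlgebraicGeometry.Motives.projectiveSpace n k).left | G ∈ (y : ProjectiveSpectrum (MvPolynomial.homogeneousSubmodule (Fin (n + 1)) k)).asHomogeneousIdeal}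 \ {((vanishingIdeal (⟨closure (Set.range ι), isClosed_closure⟩ : Closeds (Literature.AlgebraicGeometry.Motives.projectiveSpace n k).left)).subschemeι x₀ : (Literature.AlgebraicGeometry.Motives.projectiveSpace n k).left)})) \ (υ ⁻¹' {((vanishingIdeal (⟨closure (Set.range ι), isClosed_closure⟩ : Closeds (Literature.AlgebraicGeometry.Motives.projectiveSpace n k).left)).subschemeι x₀ : (Literature.AlgebraicGeometry.Motives.projectiveSpace n k).left)} ∩ closure (υ ⁻¹' ({y : (Literature.AlgebraicGeometry.Motives.projectiveSpace n k).left | ℓh ∈ (y : ProjectiveSpectrum (MvPolynomial.homogeneousSubmodule (Fin (n + 1)) k)).asHomogeneousIdeal} \ {((vanishingIdeal (⟨closure (Set.range ι), isClosed_closure⟩ : Closeds (Literature.AlgebraicGeometry.Motives.projectiveSpace n k).left)).subschemeι x₀ : (Literature.AlgebraicGeometry.Motives.projectiveSpace n k).left)})))))]) ∧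
    closure (υ' ⁻¹' (closure (υ ⁻¹' ({y : (Literature.AlgebraicGeometry.Motives.projectiveSpace n k).left | G ∈ (y : ProjectiveSpectrum (MvPolynomial.homogeneousSubmodule (Fin (n + 1)) k)).asHomogeneousIdeal} \ {((vanishingIdeal (⟨closure (Set.range ι), isClosed_closure⟩ : Closeds (Literature.AlgebraicGeometry.Motives.projectiveSpace n k).left)).subschemeι x₀ : (Literature.AlgebraicGeometry.Motives.projectiveSpace n k).left)})) \ (υ ⁻¹' {((vanishingIdeal (⟨closure (Set.range ι), isClosed_closure⟩ : Closeds (Literature.AlgebraicGeometry.Motives.projectiveSpace n k).left)).subschemeι x₀ : (Literature.AlgebraicGeometry.Motives.projectiveSpace n k).left)} ∩ closure (υ ⁻¹' ({y : (Literature.AlgebraicGeometry.Motives.projectiveSpace n k).left | ℓh ∈ (y : ProjectiveSpectrum (MvPolynomial.homogeneousSubmodule (Fin (n + 1)) k)).asHomogeneousIdeal} \ {((vanishingIdeal (⟨closure (Set.range ι), isClosed_closure⟩ : Closeds (Literature.AlgebraicGeometry.Motives.projectiveSpace n k).left)).subschemeι x₀ : (Literature.AlgebraicGeometry.Motives.projectiveSpace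 n k).left)}))))) ∈ Ls₃ ∧
    Kp₃ = some (closure (υ' ⁻¹' (closure (υ ⁻¹' ({y : (Literature.AlgebraicGeometry.Motives.projectiveSpace n k).left | G ∈ (y : ProjectiveSpectrum (MvPolynomial.homogeneousSubmodule (Fin (n + 1)) k)).asHomogeneousIdeal} \ {((vanishingIdeal (⟨closure (Set.range ι), isClosed_closure⟩ : Closeds (Literature.AlgebraicGeometry.Motives.projectiveSpace n k).left)).subschemeι x₀ : (Literature.AlgebraicGeometry.Motives.projectiveSpace n k).left)})) \ (υ ⁻¹' {((vanishingIdeal (⟨closure (Set.range ι), isClosed_closure⟩ : Closeds (Literature.AlgebraicGeometry.Motives.projectiveSpace n k).left)).subschemeι x₀ : (Literature.AlgebraicGeometry.Motives.projectiveSpace n k).left)} ∩ closure (υ ⁻¹' ({y : (Literature.AlgebraicGeometry.Motives.projectiveSpace n k).left | ℓh ∈ (y : ProjectiveSpectrum (MvPolynomial.homogeneousSubmodule (Fin (n + 1)) k)).asHomogeneousIdeal} \ {((vanishingIdeal (⟨closure (Set.range ι), isClosed_closure⟩ : Closeds (Literature.AlgebraicGeometry.Motives.projectiveSpace n k).left)).subschemeι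 x₀ : (Literature.AlgebraicGeometry.Motives.projectiveSpace n k).left)}))))), υ' ⁻¹' (υ ⁻¹' {((vanishingIdeal (⟨closure (Set.range ι), isClosed_closure⟩ : Closeds (Literature.AlgebraicGeometry.Motives.projectiveSpace n k).left)).subschemeι x₀ : (Literature.AlgebraicGeometry.Motives.projectiveSpace n k).left)} ∩ closure (υ ⁻¹' ({y : (Literature.AlgebraicGeometry.Motives.projectiveSpace n k).left | ℓh ∈ (y : ProjectiveSpectrum (MvPolynomial.homogeneousSubmodule (Fin (n + 1)) k)).asHomogeneousIdeal} \ {((vanishingIdeal (⟨closure (Set.range ι), isClosed_closure⟩ : Closeds (Literature.AlgebraicGeometry.Motives.projectiveSpace n k).left)).subschemeι x₀ : (Literature.AlgebraicGeometry.Motives.projectiveSpace n k).left)}))), closure (υ' ⁻¹' (closure (υ ⁻¹' ({y : (Literature.AlgebraicGeometry.Motives.projectiveSpace n k).left | ℓj ∈ (y : ProjectiveSpectrum (MvPolynomial.homogeneousSubmodule (Fin (n + 1)) k)).asHomogeneousIdeal} \ {((vanishingIdeal (⟨closure (Set.range ι), isClosed_closure⟩ : Closeds (Literature.AlgebraicGeometry.Motives.projectiveSpace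 n k).left)).subschemeι x₀ : (Literature.AlgebraicGeometry.Motives.projectiveSpace n k).left)})) \ (υ ⁻¹' {((vanishingIdeal (⟨closure (Set.range ι), isClosed_closure⟩ : Closeds (Literature.AlgebraicGeometry.Motives.projectiveSpace n k).left)).subschemeι x₀ : (Literature.AlgebraicGeometry.Motives.projectiveSpace n k).left)} ∩ closure (υ ⁻¹' ({y : (Literature.AlgebraicGeometry.Motives.projectiveSpace n k).left | ℓh ∈ (y : ProjectiveSpectrum (MvPolynomial.homogeneousSubmodule (Fin (n + 1)) k)).asHomogeneousIdeal} \ {((vanishingIdeal (⟨closure (Set.range ι), isClosed_closure⟩ : Closeds (Literature.AlgebraicGeometry.Motives.projectiveSpace n k).left)).subschemeι x₀ : (Literature.AlgebraicGeometry.Motives.projectiveSpace n k).left)}))))))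

/-- **`PrefixReachKeyLetterP6 k n H ι F' ρ' T'`** — the KEY-LETTER PREFIX REACH: `PrefixReachKeyLetterParam` at `Reach := ReachTowerBTriplePrime`,
`ReachL := ReachTowerBQuintPrime ℙⁿ` (A⁵, desk R53 «keep»), `LS := HyperplaneLetters`, `Open := OpeningCertKeyLetter`. [OURS · named predicate] -/
def PrefixReachKeyLetterP6 (k : Type) [Field k] [IsAlgClosed k] (n : ℕ) (H : AlgebraicGeometry.Scheme.{0})
    (ι : H ⟶ (Literature.AlgebraicGeometry.Motives.projectiveSpace n k).left) (F' : AlgebraicGeometry.Scheme.{0}) (ρ' : F' ⟶ (Literature.AlgebraicGeometry.Motives.projectiveSpace n k).left) (T' : Set F') : Prop :=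
  PrefixReachKeyLetterParam k n H ι ReachTowerBTriplePrime (ReachTowerBQuintPrime (Literature.AlgebraicGeometry.Motives.projectiveSpace n k).left) (HyperplaneLetters k n H ι) (OpeningCertKeyLetter k n H ι) F' ρ' T'

/-- **`IsoHypReachNDLeavesP6 k n H ι`** — «a KEY-LETTER prefix ends at a stage with (pointwise) ND LEAVES»: (K6-1P) over `PrefixReachKeyLetterP6`.
[OURS · L1 W4.5b · named hypothesis, no mathematical content of its own] -/
def IsoHypReachNDLeavesP6 (k : Type) [Field k] [IsAlgClosed k] (n : ℕ) (H : AlgebraicGeometry.Scheme.{0})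
    (ι : H ⟶ (Literature.AlgebraicGeometry.Motives.projectiveSpace n k).left) : Prop :=
  ∃ (F : AlgebraicGeometry.Scheme.{0}) (ρ : F ⟶ (Literature.AlgebraicGeometry.Motives.projectiveSpace n k).left) (T : Set F) (m : ℕ),
    PrefixReachKeyLetterP6 k n H ι F ρ T ∧ ND.NDInvCLNP n k m F ρ T

/-- **Prefix⁵ ⊆ prefix⁶**: run the lettered motive at the trivial slots `[] none` through the tree's `PrefixReachBQuintPrime` closure — (Pc)/(PL) are
its two clauses at those slots. [OURS · pure logic] -/
theorem prefixReachKeyLetterP6_of_quint (k : Type) [Field k] [IsAlgClosed k] (n : ℕ) (H : AlgebraicGeometry.Scheme.{0})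
    (ι : H ⟶ (Literature.AlgebraicGeometry.Motives.projectiveSpace n k).left) (F' : AlgebraicGeometry.Scheme.{0}) (ρ' : F' ⟶ (Literature.AlgebraicGeometry.Motives.projectiveSpace n k).left) (T' : Set F')
    (h : PrefixReachBQuintPrime k n H ι F' ρ' T') : PrefixReachKeyLetterP6 k n H ι F' ρ' T' := by
  intro Q h0 _ hPc hPL _ _ _ _
  refine ⟨[], none, h (fun F ρ T => Q F ρ T [] none) h0 ?_ ?_⟩
  · intro F₁ F₂ ρ T₁ x υ hx hQ1 hn hr hυ
    exact hPc F₁ F₂ ρ T₁ [] none x υ hx hQ1 hn hr hυ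
  · intro F₂ x₀ υ hx₀ Ls₂ hn hr hυ hLs F₉ β T₉ hR
    exact hPL F₂ x₀ υ hx₀ Ls₂ hn hr hυ hLs F₉ β T₉ hR

/-- **Prefix⁴ ⊆ prefix⁶** (via ✓ `prefixReachBQuintPrime_of_quad`). [OURS · pure logic] -/
theorem prefixReachKeyLetterP6_of_quad (k : Type) [Field k] [IsAlgClosed k] (n : ℕ) (H : AlgebraicGeometry.Scheme.{0})
    (ι : H ⟶ (Literature.AlgebraicGeometry.Motives.projectiveSpace n k).left) (F' : AlgebraicGeometry.Scheme.{0}) (ρ' : F' ⟶ (Literature.AlgebraicGeometry.Motives.projectiveSpace n k).left) (T' : Set F')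
    (h : PrefixReachBQuadPrime k n H ι F' ρ' T') : PrefixReachKeyLetterP6 k n H ι F' ρ' T' :=
  prefixReachKeyLetterP6_of_quint k n H ι F' ρ' T' (prefixReachBQuintPrime_of_quad k n H ι F' ρ' T' h)

/-- ★ **Inclusion P ⊆ P6** (the REPLACE cut `¬ IsoHypReachNDLeavesP ↦ ¬ IsoHypReachNDLeavesP6` loses nothing). [OURS · pure logic] -/
theorem isoHypReachNDLeavesP6_of_P (k : Type) [Field k] [IsAlgClosed k] (n : ℕ) (H : AlgebraicGeometry.Scheme.{0})
    (ι : H ⟶ (Literature.AlgebraicGeometry.Motives.projectiveSpace n k).left) (h : IsoHypReachNDLeavesP k n H ι) : IsoHypReachNDLeavesP6 k n H ι := by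
  obtain ⟨F, ρ, T, m, hpre, hND⟩ := h
  exact ⟨F, ρ, T, m, prefixReachKeyLetterP6_of_quad k n H ι F ρ T hpre, hND⟩

/-- **Inclusion P5 ⊆ P6**. [OURS · pure logic] -/
theorem isoHypReachNDLeavesP6_of_P5 (k : Type) [Field k] [IsAlgClosed k] (n : ℕ) (H : AlgebraicGeometry.Scheme.{0})
    (ι : H ⟶ (Literature.AlgebraicGeometry.Motives.projectiveSpace n k).left) (h : IsoHypReachNDLeavesP5 k n H ι) : IsoHypReachNDLeavesP6 k n H ι := by
  obtain ⟨F, ρ, T, m, hpre, hND⟩ := h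
  exact ⟨F, ρ, T, m, prefixReachKeyLetterP6_of_quint k n H ι F ρ T hpre, hND⟩

/-- Contrapositive form, as the REPLACE cut consumes it (the REGISTERED hypothesis #22 is `¬ IsoHypReachNDLeavesP`). [OURS · pure logic] -/
theorem not_isoHypReachNDLeavesP_of_not_P6 (k : Type) [Field k] [IsAlgClosed k] (n : ℕ) (H : AlgebraicGeometry.Scheme.{0})
    (ι : H ⟶ (Literature.AlgebraicGeometry.Motives.projectiveSpace n k).left) (h : ¬ IsoHypReachNDLeavesP6 k n H ι) : ¬ IsoHypReachNDLeavesP k n H ι :=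
  fun h' => h (isoHypReachNDLeavesP6_of_P k n H ι h')

end Summit.ResolutionOfSingularities.ResolutionOfSingularities.Cruxes.EquisingularLiftNat.Sections

end
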